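import Summits.QuantumFields.YangMills.Theorems.FluctuationComparisonRegPrIntLS2BetaPeanoSmooth
import Summits.QuantumFields.YangMills.Theorems.FluctuationComparisonRegPrIntLS2BetaChartContLaplaceRows
import Summits.QuantumFields.YangMills.Theorems.FluctuationComparisonRegPrIntLS2BetaTubularChartDockTransversal
import Summits.QuantumFields.YangMills.Theorems.FluctuationComparisonRegPrIntLS2BetaPivotStabiliser
import HarnessLib

/-!
# S2β · LAPLACE row — THE `ChartSmooth` SUPPLIER: v8.1's `stub_chartSmooth` IS A THEOREM OF THE LANDED ROWS (pen w5-20520 g14)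

Cell `ym3-torus` (rung R3: continuum `SU(2)` Yang–Mills on `T³` — NOT `d = 4`, NOT infinite volume, NOT a mass gap, NOT Clay); width seat `ym-ust-20520-w5` g14;
helper of the crux `stmt-QuantumFields-20520` (`--supports`, NOT a proof of it).  THEOREMS ONLY (0 `def`, 0 `sorry`; default heartbeats).

WHAT.  `Lines/semiclassical_s2beta.lean` v8.1 (w4-20520 g15, LINE OWNER WORD 12) displays the stub `stub_chartSmooth : ChartSmooth` — for every `(L, b₀, p₀, ε₀)` in GAP♯'s
prefix and `γ ≤ γ₁`, every `J ≤ K`: common dimensions `dZ dV`, a sheet set `Sst`, ONE window chart `c` on `histGood` over the `θ_J`-window with the `ChartRows`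
(CHART∞'s nine LIMIT rows + continuity of `c.Φ (V,·)` + off-pivot agreement + descent + recognition∕carrier-neighbourhood), and for every window datum `V` and every
minimising small-field history `U₀ ∈ argminHist V` the `ChartPackage` (group chart `e`, transversal `σ` with the LOCAL carrier row, the (T2) transversality row, the
tubular Haar chart rows, the stabiliser rows for `Sst`, and the `C²` row).  THIS FILE proves that statement — with `ChartRows`, `ChartPackage`, `argminHist` UNFOLDED to
their v8.1 bodies token for token (the Lines-side `def`s are not importable; v9's `stub_chartSmooth` is then `exact …ChartSmooth.chartSmooth` by `δ`-unfolding, the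
door pattern of ✓F6 `windowRegularity`) — from the landed suppliers BY NAME: CHART∞ V-c3 ✓`…ChartContLaplaceRows.exists_laplaceRows` (w3-20520 g14), (C3β″)+(T2)
✓`…TubularChartDockTransversal.exists_tubularHaarChart_pivotAct_transversal` (px21 g9∕g10), RG-K∕`hstab`∕`hfix` ✓`…PivotStabiliser.pivotAct_eq_self_iff_central`
(px21∕px11), (C2) ✓`…PeanoSmooth.contDiffAt_wilsonAction4_windowChart_of_histGood` + ✓`exists_gamma_chainRegime` (w5 g14 ∘ px11 g10's (C2-b)); `pS := 0`, `ε₁ := 1`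
(free), `γ₁ := min (γ₁ of CHART∞) (γ₁ of the chain regime)`, `Sst :=` the central sheet set `{k | k.2 = 1 ∧ ∃ c central, ↑k.1 = const c}`.

HONEST SCOPE.  Assembly; closes ONE of v8.1's displayed stubs when the line file calls it; LAPLACE then rests on EXW + GAP♯ + FOUR-POINT-DECAY (and S2β on those + H4ᶜ +
LFR♯ᶜ); nothing of EXW ∕ GAP♯ ∕ DECAY ∕ H4ᶜ ∕ LFR♯ᶜ is proved; the crux 20520 is NOT proved; `YM3TorusSU2` NOT proved; the Yang–Mills mass gap (Clay) NOT proved.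

References: [Balaban1985Averaging] §E Prop 6 pp. 26–27; [Balaban1985Variational] CMP 102 (1985) Thm 1 (8)–(10) p. 279 and (142) p. 299; [Helgason2000] Ch. I §1 Thm 1.14 p. 96;
[Breitung1994] Thm 41 p. 56; [Dieudonne1960] Ch. X §2 (10.2.1)–(10.2.3).
-/

noncomputable section

open MeasureTheory Filter Topology Set
open Literature.MathematicalPhysics.QuantumFieldTheory.Balaban1983to89
open Literature.MathematicalPhysics.QuantumFieldTheory.Balaban1983to89.T3ContinuumYM3Torus
open Literature.MathematicalPhysics.QuantumFieldTheory.Balaban1983to89.T3NestedUnitLaws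
open Literature.MathematicalPhysics.QuantumFieldTheory.Balaban1983to89.T3UnitLawDensityEML
open Literature.MathematicalPhysics.QuantumFieldTheory.Balaban1983to89.T3UnitScaleTilt
open Literature.MathematicalPhysics.QuantumFieldTheory.Balaban1983to89.T3TiltDescent
open Literature.MathematicalPhysics.QuantumFieldTheory.Balaban1983to89.T3PrintedRegularMinimiser
open Literature.MathematicalPhysics.QuantumFieldTheory.Balaban1983to89.T3ConstrainedMinimiser (fibre)
open Literature.MathematicalPhysics.QuantumFieldTheory.Balaban1983to89.T3LevelShift
open Literature.MathematicalPhysics.QuantumFieldTheory.Balaban1983to89.T3Thresholds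
open Literature.MathematicalPhysics.QuantumFieldTheory.Balaban1983to89.Missing
open Literature.MathematicalPhysics.QuantumFieldTheory.Balaban1983to89.T4Continuum
open scoped Literature.MathematicalPhysics.QuantumFieldTheory.Balaban1983to89.T3OrbitAverage
open scoped Matrix.Norms.L2Operator
open Summit.QuantumFields.YangMills.Theorems.FluctuationComparisonRegPrIntLS2BetaChartContLaplaceRows (exists_laplaceRows)
open Summit.QuantumFields.YangMills.Theorems.FluctuationComparisonRegPrIntLS2BetaTubularChartDockTransversal (exists_tubularHaarChart_pivotAct_transversal)
open Summit.QuantumFields.YangMills.Theorems.FluctuationComparisonRegPrIntLS2BetaPivotStabiliser (pivotAct_eq_self_iff_central)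
open Summit.QuantumFields.YangMills.Theorems.FluctuationComparisonRegPrIntLS2BetaPeanoSmooth (contDiffAt_wilsonAction4_windowChart_of_histGood exists_gamma_chainRegime)

namespace Summit.QuantumFields.YangMills.Theorems.FluctuationComparisonRegPrIntLS2BetaChartSmooth

/-- ★★★ **THE `ChartSmooth` SUPPLIER** — v8.1's `ChartSmooth` with `ChartRows`, `ChartPackage`, `argminHist` unfolded to their bodies token for token; proved from the
landed rows by name (CHART∞ V-c3, (C3β″)+(T2) dock, the stabiliser characterisation, the (C2) Peano smoothness row in the chain regime).
[cite: Balaban1985Averaging, §E Prop 6 p.26-27] [cite: Balaban1985Variational, Thm 1 (8)-(10) p.279] [cite: Helgason2000, Ch. I §1 Thm 1.14 p.96] [cite: Dieudonne1960, Ch. X §2 (10.2.1)] -/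
theorem chartSmooth :
    ∀ (L : ℕ), ∃ pS : ℝ, ∀ (b₀ p₀ : ℝ), 0 < b₀ → pS ≤ p₀ → 0 < p₀ → ∃ ε₁ : ℝ, 0 < ε₁ ∧ ∀ (ε₀ : ℝ), 0 < ε₀ → ε₀ ≤ ε₁ →
    ∃ γ₁ : ℝ, 0 < γ₁ ∧ ∀ (F : T3Family) (γ : ℝ), F.L = L → 0 < γ → γ ≤ γ₁ →
    ∀ (J K : ℕ) (hJK : J ≤ K),
    ∃ (dZ dV : ℕ) (Sst : Set (↥(Summit.QuantumFields.YangMills.Theorems.FluctuationComparisonRegPrIntLS2BetaResidualSubgroup.residualSubgroup F hJK) × (PBond (F.P K) (K - J) → (Matrix.specialUnitaryGroup (Fin 2) ℂ)))) (c : Summit.QuantumFields.YangMills.Theorems.FluctuationComparisonRegPrIntLWregGlue.WindowChart F hJK (histGood F ℰp (θBal F.L γ b₀ p₀) K J) {V : GaugeField (F.P J) 0 (Matrix.specialUnitaryGroup (Fin 2) ℂ) | PlaqSmall (θBal F.L γ b₀ p₀ J) V}),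
    (∀ V : GaugeField (F.P J) 0 (Matrix.specialUnitaryGroup (Fin 2) ℂ),
    IsCompact {z : GaugeField (F.P K) 0 (Matrix.specialUnitaryGroup (Fin 2) ℂ) | c.jac (V, z) ≠ 0} ∧
    (∀ k z, z ∈ {z : GaugeField (F.P K) 0 (Matrix.specialUnitaryGroup (Fin 2) ℂ) | c.jac (V, z) ≠ 0} → Summit.QuantumFields.YangMills.Theorems.FluctuationComparisonRegPrIntLS2BetaResidualSubgroup.pivotAct F hJK (Summit.QuantumFields.YangMills.Theorems.FluctuationComparisonRegPrIntLWregChain.iterCentralBond (P := F.P K) (K - J)) k z ∈ {z : GaugeField (F.P K) 0 (Matrix.specialUnitaryGroup (Fin 2) ℂ) | c.jac (V, z) ≠ 0}) ∧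
    (∀ z, z ∉ {z : GaugeField (F.P K) 0 (Matrix.specialUnitaryGroup (Fin 2) ℂ) | c.jac (V, z) ≠ 0} → (c.jac (V, z) : ℝ) = 0) ∧
    ContinuousOn (fun z => wilsonAction4 (c.Φ (V, z))) {z : GaugeField (F.P K) 0 (Matrix.specialUnitaryGroup (Fin 2) ℂ) | c.jac (V, z) ≠ 0} ∧
    ContinuousOn (fun z => (c.jac (V, z) : ℝ)) {z : GaugeField (F.P K) 0 (Matrix.specialUnitaryGroup (Fin 2) ℂ) | c.jac (V, z) ≠ 0} ∧
    ContinuousOn (fun z => c.Φ (V, z)) {z : GaugeField (F.P K) 0 (Matrix.specialUnitaryGroup (Fin 2) ℂ) | c.jac (V, z) ≠ 0} ∧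
    (∀ k, ∀ z ∈ {z : GaugeField (F.P K) 0 (Matrix.specialUnitaryGroup (Fin 2) ℂ) | c.jac (V, z) ≠ 0}, wilsonAction4 (c.Φ (V, Summit.QuantumFields.YangMills.Theorems.FluctuationComparisonRegPrIntLS2BetaResidualSubgroup.pivotAct F hJK (Summit.QuantumFields.YangMills.Theorems.FluctuationComparisonRegPrIntLWregChain.iterCentralBond (P := F.P K) (K - J)) k z)) = wilsonAction4 (c.Φ (V, z))) ∧
    (∀ k, ∀ z ∈ {z : GaugeField (F.P K) 0 (Matrix.specialUnitaryGroup (Fin 2) ℂ) | c.jac (V, z) ≠ 0}, (c.jac (V, Summit.QuantumFields.YangMills.Theorems.FluctuationComparisonRegPrIntLS2BetaResidualSubgroup.pivotAct F hJK (Summit.QuantumFields.YangMills.Theorems.FluctuationComparisonRegPrIntLWregChain.iterCentralBond (P := F.P K) (K - J)) k z) : ℝ) = c.jac (V, z)) ∧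
    IsOpen ((Subtype.val : {z : GaugeField (F.P K) 0 (Matrix.specialUnitaryGroup (Fin 2) ℂ) | c.jac (V, z) ≠ 0} → GaugeField (F.P K) 0 (Matrix.specialUnitaryGroup (Fin 2) ℂ)) ⁻¹' {z | c.Φ (V, z) ∈ (histGood F ℰp (θBal F.L γ b₀ p₀) K J)}) ∧
    (∀ k, ∀ z ∈ {z : GaugeField (F.P K) 0 (Matrix.specialUnitaryGroup (Fin 2) ℂ) | c.jac (V, z) ≠ 0}, c.Φ (V, z) ∈ (histGood F ℰp (θBal F.L γ b₀ p₀) K J) → c.Φ (V, Summit.QuantumFields.YangMills.Theorems.FluctuationComparisonRegPrIntLS2BetaResidualSubgroup.pivotAct F hJK (Summit.QuantumFields.YangMills.Theorems.FluctuationComparisonRegPrIntLWregChain.iterCentralBond (P := F.P K) (K - J)) k z) ∈ (histGood F ℰp (θBal F.L γ b₀ p₀) K J)) ∧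
    (∀ z ∈ {z : GaugeField (F.P K) 0 (Matrix.specialUnitaryGroup (Fin 2) ℂ) | c.jac (V, z) ≠ 0}, ∀ b, (∀ c', Summit.QuantumFields.YangMills.Theorems.FluctuationComparisonRegPrIntLWregChain.iterCentralBond (P := F.P K) (K - J) c' ≠ b) → c.Φ (V, z) b = z b) ∧
    (∀ z ∈ {z : GaugeField (F.P K) 0 (Matrix.specialUnitaryGroup (Fin 2) ℂ) | c.jac (V, z) ≠ 0}, descendTo F ℰp J K hJK (c.Φ (V, z)) = V) ∧
    (∀ U, descendTo F ℰp J K hJK U = V → U ∈ (histGood F ℰp (θBal F.L γ b₀ p₀) K J) → (c.jac (V, U) ≠ 0 ∧ c.Φ (V, U) = U) ∧ {z : GaugeField (F.P K) 0 (Matrix.specialUnitaryGroup (Fin 2) ℂ) | c.jac (V, z) ≠ 0} ∈ 𝓝 U)) ∧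
    ∀ (V : GaugeField (F.P J) 0 (Matrix.specialUnitaryGroup (Fin 2) ℂ)), PlaqSmall (θBal F.L γ b₀ p₀ J) V → ∀ U₀ ∈ {U' : GaugeField (F.P K) 0 (Matrix.specialUnitaryGroup (Fin 2) ℂ) | U' ∈ fibre F ℰp J K hJK V ∧ U' ∈ histGood F ℰp (θBal F.L γ b₀ p₀) K J ∧ wilsonAction4 U' = minActionRegPr F J K hJK ε₀ V},
    (∃ (e : EuclideanSpace ℝ (Fin dZ) → (↥(Summit.QuantumFields.YangMills.Theorems.FluctuationComparisonRegPrIntLS2BetaResidualSubgroup.residualSubgroup F hJK) × (PBond (F.P K) (K - J) → (Matrix.specialUnitaryGroup (Fin 2) ℂ)))) (σ : EuclideanSpace ℝ (Fin dV) → GaugeField (F.P K) 0 (Matrix.specialUnitaryGroup (Fin 2) ℂ)) (W : Set (EuclideanSpace ℝ (Fin dZ) × EuclideanSpace ℝ (Fin dV))) (Jd : EuclideanSpace ℝ (Fin dZ) × EuclideanSpace ℝ (Fin dV) → ℝ) (ρ : ℝ),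
    Continuous e ∧ e 0 = 1 ∧ 𝓝 (1 : (↥(Summit.QuantumFields.YangMills.Theorems.FluctuationComparisonRegPrIntLS2BetaResidualSubgroup.residualSubgroup F hJK) × (PBond (F.P K) (K - J) → (Matrix.specialUnitaryGroup (Fin 2) ℂ)))) ≤ map e (𝓝 0) ∧
    Continuous σ ∧ σ 0 = U₀ ∧ (∀ᶠ y in 𝓝 (0 : EuclideanSpace ℝ (Fin dV)), σ y ∈ {z : GaugeField (F.P K) 0 (Matrix.specialUnitaryGroup (Fin 2) ℂ) | c.jac (V, z) ≠ 0}) ∧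
    (∃ c₁ : ℝ, 0 < c₁ ∧ ∀ᶠ y in 𝓝 (0 : EuclideanSpace ℝ (Fin dV)),
    c₁ * ‖y‖ ^ 2 ≤ ⨅ w : {w : Site (F.P K) 0 → (Matrix.specialUnitaryGroup (Fin 2) ℂ) |
    ∀ U : GaugeField (F.P K) 0 (Matrix.specialUnitaryGroup (Fin 2) ℂ), descendTo F ℰp J K hJK (GaugeField.gaugeAct w U) = descendTo F ℰp J K hJK U},
    ∑ ℓ ∈ Finset.univ.filter (fun ℓ : PBond (F.P K) 0 => ∀ c', Summit.QuantumFields.YangMills.Theorems.FluctuationComparisonRegPrIntLWregChain.iterCentralBond (P := F.P K) (K - J) c' ≠ ℓ),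
    dist1 (σ y ℓ * ((GaugeField.gaugeAct (w : Site (F.P K) 0 → (Matrix.specialUnitaryGroup (Fin 2) ℂ)) U₀) ℓ)⁻¹) ^ 2) ∧
    𝓝 (σ 0) ≤ map (fun p : EuclideanSpace ℝ (Fin dZ) × EuclideanSpace ℝ (Fin dV) => Summit.QuantumFields.YangMills.Theorems.FluctuationComparisonRegPrIntLS2BetaResidualSubgroup.pivotAct F hJK (Summit.QuantumFields.YangMills.Theorems.FluctuationComparisonRegPrIntLWregChain.iterCentralBond (P := F.P K) (K - J)) (e p.1) (σ p.2)) (𝓝 0) ∧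
    IsOpen W ∧ InjOn (fun p : EuclideanSpace ℝ (Fin dZ) × EuclideanSpace ℝ (Fin dV) => Summit.QuantumFields.YangMills.Theorems.FluctuationComparisonRegPrIntLS2BetaResidualSubgroup.pivotAct F hJK (Summit.QuantumFields.YangMills.Theorems.FluctuationComparisonRegPrIntLWregChain.iterCentralBond (P := F.P K) (K - J)) (e p.1) (σ p.2)) W ∧
    ContinuousOn Jd W ∧ (∀ w ∈ W, 0 ≤ Jd w) ∧
    (fieldMeasure (F.P K) 0 (Matrix.specialUnitaryGroup (Fin 2) ℂ)).restrict ((fun p : EuclideanSpace ℝ (Fin dZ) × EuclideanSpace ℝ (Fin dV) => Summit.QuantumFields.YangMills.Theorems.FluctuationComparisonRegPrIntLS2BetaResidualSubgroup.pivotAct F hJK (Summit.QuantumFields.YangMills.Theorems.FluctuationComparisonRegPrIntLWregChain.iterCentralBond (P := F.P K) (K - J)) (e p.1) (σ p.2)) '' W) =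
    ((((volume : Measure (EuclideanSpace ℝ (Fin dZ))).prod (volume : Measure (EuclideanSpace ℝ (Fin dV)))).restrict W).withDensity fun w => ENNReal.ofReal (Jd w)).map
    (fun p : EuclideanSpace ℝ (Fin dZ) × EuclideanSpace ℝ (Fin dV) => Summit.QuantumFields.YangMills.Theorems.FluctuationComparisonRegPrIntLS2BetaResidualSubgroup.pivotAct F hJK (Summit.QuantumFields.YangMills.Theorems.FluctuationComparisonRegPrIntLWregChain.iterCentralBond (P := F.P K) (K - J)) (e p.1) (σ p.2)) ∧
    0 < ρ ∧ Metric.closedBall (0 : EuclideanSpace ℝ (Fin dZ)) ρ ×ˢ {(0 : EuclideanSpace ℝ (Fin dV))} ⊆ W ∧ 0 < ∫ z in Metric.ball (0 : EuclideanSpace ℝ (Fin dZ)) ρ, Jd (z, 0) ∧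
    (∀ k, Summit.QuantumFields.YangMills.Theorems.FluctuationComparisonRegPrIntLS2BetaResidualSubgroup.pivotAct F hJK (Summit.QuantumFields.YangMills.Theorems.FluctuationComparisonRegPrIntLWregChain.iterCentralBond (P := F.P K) (K - J)) k (σ 0) = σ 0 → k ∈ Sst) ∧ (∀ s ∈ Sst, ∀ y, Summit.QuantumFields.YangMills.Theorems.FluctuationComparisonRegPrIntLS2BetaResidualSubgroup.pivotAct F hJK (Summit.QuantumFields.YangMills.Theorems.FluctuationComparisonRegPrIntLWregChain.iterCentralBond (P := F.P K) (K - J)) s (σ y) = σ y) ∧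
    ContDiffAt ℝ 2 (fun y => wilsonAction4 (c.Φ (V, σ y))) 0) := by
  intro L
  refine ⟨0, fun b₀ p₀ hb _ hp => ⟨1, one_pos, fun ε₀ _ _ => ?_⟩⟩
  obtain ⟨γ₁, hγ₁, hLR⟩ := exists_laplaceRows L b₀ p₀ hb hp
  obtain ⟨α, γ₂, _, hα24, hαδ, hγ₂, hreg⟩ := exists_gamma_chainRegime L b₀ p₀ hb hp
  refine ⟨min γ₁ γ₂, lt_min hγ₁ hγ₂, fun F γ hFL hγ hγle J K hJK => ?_⟩
  obtain ⟨c, T, w, h1, h2, h3, -, -, -, h7, h8, -, -, h11, -, hrows⟩ := hLR F γ hFL hγ (hγle.trans (min_le_left _ _)) J K hJK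
  obtain ⟨hαL, hθ0, hθα⟩ := hreg F γ hFL hγ (hγle.trans (min_le_right _ _)) K
  have hk : K - J ≤ (F.P K).m + (F.P K).K := by
    show K - J ≤ F.m + K
    omega
  -- live ⇒ off-pivot agreement (clauses 2 + 8)
  have hoff : ∀ V z, c.jac (V, z) ≠ 0 → ∀ b, (∀ c', FluctuationComparisonRegPrIntLWregChain.iterCentralBond (P := F.P K) (K - J) c' ≠ b) → c.Φ (V, z) b = z b :=
    fun V z hz => (h8 V z ((h2 V z).1 hz).1).1
  refine ⟨Module.finrank ℝ (specialUnitaryLogChart (Fin 2)).lie *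
      ((Fintype.card (Site (F.P K) 0) - Fintype.card (Site (F.P K) (K - J))) + Fintype.card (PBond (F.P K) (K - J))),
    Module.finrank ℝ (specialUnitaryLogChart (Fin 2)).lie * (Fintype.card (PBond (F.P K) 0) - Fintype.card (PBond (F.P K) (K - J))) -
      Module.finrank ℝ (specialUnitaryLogChart (Fin 2)).lie * (Fintype.card (Site (F.P K) 0) - Fintype.card (Site (F.P K) (K - J))),
    {k : ↥(FluctuationComparisonRegPrIntLS2BetaResidualSubgroup.residualSubgroup F hJK) × (PBond (F.P K) (K - J) → Matrix.specialUnitaryGroup (Fin 2) ℂ) |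
      k.2 = 1 ∧ ∃ c₀ : Matrix.specialUnitaryGroup (Fin 2) ℂ, (∀ g : Matrix.specialUnitaryGroup (Fin 2) ℂ, c₀ * g = g * c₀) ∧
        (k.1 : Site (F.P K) 0 → Matrix.specialUnitaryGroup (Fin 2) ℂ) = fun _ => c₀}, c, ?_, ?_⟩
  · -- `ChartRows c`
    intro V
    obtain ⟨hXc, hXinv, hvan, hA, ha, hAinv, hainv, hOrel, hOinv⟩ := hrows V
    exact ⟨hXc, hXinv, hvan, hA, ha, (h3 V).1, hAinv, hainv, hOrel, hOinv, fun z hz => hoff V z hz, fun z hz => h1 V z hz,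
      fun U hUV hU => ⟨h7 V U hUV (subset_closure hU), h11 V U hUV hU⟩⟩
  · -- `ChartPackage` at every minimising small-field history
    intro V _ U₀ hU₀
    obtain ⟨hU₀f, hU₀h, -⟩ := hU₀
    have hU₀V : descendTo F ℰp J K hJK U₀ = V := hU₀f
    obtain ⟨e, σ, W, Jd, ρ, he, he1, he𝓝, hσ, hσ0, hσs, -, -, hT2, hΘ'𝓝, hWo, hinj, hJc, hJ0, hchart, hρ, hρW, hJ00⟩ :=
      exists_tubularHaarChart_pivotAct_transversal F hJK hk _ _ rfl rfl U₀
    have hlive : c.jac (V, U₀) ≠ 0 := (h7 V U₀ hU₀V (subset_closure hU₀h)).1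
    have hself : c.Φ (V, U₀) = U₀ := (h7 V U₀ hU₀V (subset_closure hU₀h)).2
    have hnhds : {z | c.jac (V, z) ≠ 0} ∈ 𝓝 U₀ := h11 V U₀ hU₀V hU₀h
    have hσX : ∀ᶠ y in 𝓝 (0 : EuclideanSpace ℝ (Fin _)), σ y ∈ {z : GaugeField (F.P K) 0 (Matrix.specialUnitaryGroup (Fin 2) ℂ) | c.jac (V, z) ≠ 0} :=
      hσ.continuousAt.preimage_mem_nhds (by rw [hσ0]; exact hnhds)
    refine ⟨e, σ, W, Jd, ρ, he, he1, he𝓝, hσ, hσ0, hσX, hT2, hΘ'𝓝, hWo, hinj, hJc, hJ0, hchart, hρ, hρW, hJ00,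
      fun k hk' => (pivotAct_eq_self_iff_central F hJK hk k (σ 0)).1 hk', fun s hs y => (pivotAct_eq_self_iff_central F hJK hk s (σ y)).2 hs, ?_⟩
    exact contDiffAt_wilsonAction4_windowChart_of_histGood F hJK hk hα24 hαδ hαL hθ0 hθα c V U₀ (h1 V) (hoff V) (h3 V).1 hlive hself hnhds hU₀V hU₀h
      σ hσ hσ0 hσs 2

end Summit.QuantumFields.YangMills.Theorems.FluctuationComparisonRegPrIntLS2BetaChartSmooth

end
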